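import Mathlib
import Literature.AlgebraicGeometry.Resolution.CobordantGame
import Literature.AlgebraicGeometry.Resolution.FormalCoordinateChange
import Summits.ResolutionOfSingularities.ResolutionOfSingularities.Theorems.WeightedInvariantLocalWeightedDropPlaneWon
import Summits.ResolutionOfSingularities.ResolutionOfSingularities.Theorems.WeightedInvariantLocalWeightedDropTerminalDoublePointsAux
import Summits.ResolutionOfSingularities.ResolutionOfSingularities.Theorems.WeightedInvariantLocalWeightedDropTerminalDoublePoints
import Summits.ResolutionOfSingularities.ResolutionOfSingularities.Theorems.WeightedInvariantLocalWeightedDropInsepPointStep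
import Summits.ResolutionOfSingularities.ResolutionOfSingularities.Theorems.WeightedInvariantLocalWeightedDropSeparablePointStep

/-!
# `WeightedInvariant.LocalWeightedDrop`, line `hasse-ridge-face-selection`: toolkit for explicit INSEP walks, and the
# «three lines» position `y² + x₀x₁(a x₁² + e x₀²)`

Crux item stmt-ResolutionOfSingularities-8899 `LocalWeightedDrop` (route `ResolutionOfSingularities/WeightedInvariant`),
serving the door `WeightedConstruction` stmt-ResolutionOfSingularities-0571.  [OURS · L1 W4.3, chain w43, stub worker 3
(gen 2): calibration (c3) of CRUX-PLAN v2 in kernel form — explicit walks through the cleaned point/curve steps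
(`won_insep_of_pointStep`, `won_insep_of_curveStep`) down to the terminal double points (`binomialDoublePointWon`); NOT a
statement of any manuscript.]

* bookkeeping for explicit positions `Σ C a · x₀^r x₁^s`: substitution (`KangarooWalk.subst_term`), order bounds
  (`le_order_term`, `le_order_add'`), the «no cleaning needed» case `ord ≥ 3` (`eq_zero_of_sq_eq_coeff`,
  `add_sq_eq_self`), the «order-1 successor» contradiction (`false_of_coeff_single_one_ne_zero`), cancellation of `x₀²`
  (linear coefficients and `2 = 0` from stub worker 2's `SepTerminalDoublePoint` / `SepPointStep`);
* `KangarooWalk.threeLines_chart`: ONE chart of the point blow-up of the three-lines position `x₀x₁(a x₁² + e x₀²)`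
  (`a, e ≠ 0`; in characteristic `2` this is `x₀x₁(√a x₁ + √e x₀)²`): the cleaned successor is terminal `x₀²x₁·unit`, or —
  on the special line `a c₁² = e c₀²` — `x₀²x₁²(c₁ + x₁)·unit`, which one more cleaning turns into the terminal `x₀²x₁³·unit`;
* `threeLinesDoublePointWon`: `y² + x₀x₁(a x₁² + e x₀²)` is won (characteristic `2`, `k` algebraically closed).
-/

set_option linter.dupNamespace false -- mandated namespace of this single-conjunct summit

namespace Summit.ResolutionOfSingularities.ResolutionOfSingularities.Theorems

open Literature.AlgebraicGeometry.Resolution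
open Literature.AlgebraicGeometry.Resolution.CobordantGame

namespace KangarooWalk

open MvPowerSeries

variable {k : Type} [Field k]

/-! ### Bookkeeping for explicit positions -/

/-- Substituting into one term `C a · x₀^r x₁^s`. -/
theorem subst_term {τ : Fin 2 → MvPowerSeries (Fin 2) k} (hτ : HasSubst τ) (a : k) (r s : ℕ) :
    subst τ (C a * X 0 ^ r * X 1 ^ s) = C a * τ 0 ^ r * τ 1 ^ s := by
  rw [subst_mul hτ, subst_mul hτ, subst_pow hτ, subst_pow hτ, subst_X hτ, subst_X hτ, subst_C]

/-- The order of one term is at least its degree. -/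
theorem le_order_term (a : k) (r s : ℕ) : ((r + s : ℕ) : ℕ∞) ≤ (C a * X 0 ^ r * X 1 ^ s : MvPowerSeries (Fin 2) k).order := by
  rw [mul_assoc, ← smul_eq_C_mul, TerminalDoublePoint.X_pow_mul_X_pow_eq]
  refine le_trans ?_ le_order_smul
  rw [order_monomial_of_ne_zero one_ne_zero, map_add, Finsupp.degree_single, Finsupp.degree_single]

/-- Orders of sums. -/
theorem le_order_add' {n : ℕ∞} {f g : MvPowerSeries (Fin 2) k} (hf : n ≤ f.order) (hg : n ≤ g.order) :
    n ≤ (f + g).order :=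
  le_trans (le_min hf hg) min_order_le_add

/-- No cleaning is needed when `ord A ≥ 3`: a square root of a degree-`2` coefficient vanishes. -/
theorem eq_zero_of_sq_eq_coeff {A : MvPowerSeries (Fin 2) k} (h3 : ((3 : ℕ) : ℕ∞) ≤ A.order) (i : Fin 2) {α : k}
    (hα : α ^ 2 = coeff (Finsupp.single i 2) A) : α = 0 := by
  have h : coeff (Finsupp.single i 2) A = 0 :=
    coeff_of_lt_order (by rw [Finsupp.degree_single]; exact lt_of_lt_of_le (by exact_mod_cast Nat.lt_succ_self 2) h3)
  rw [h] at hα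
  exact pow_eq_zero_iff two_ne_zero |>.mp hα

/-- … and then the cleaned successor is the successor itself. -/
theorem add_sq_eq_self {A : MvPowerSeries (Fin 2) k} {α β : k} (hα : α = 0) (hβ : β = 0) :
    A + (C α * X 0 + C β * X 1) ^ 2 = A := by
  subst hα; subst hβ
  simp

/-- The square of the cleaning form has order `≥ 2`. -/
theorem two_le_order_sq_linear (α β : k) : ((2 : ℕ) : ℕ∞) ≤ ((C α * X 0 + C β * X 1 : MvPowerSeries (Fin 2) k) ^ 2).order :=
  le_order_pow_of_constantCoeff_eq_zero 2 (by simp [constantCoeff_X])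

/-- THE ORDER-`1` SUCCESSOR IS NOT A POSITION: if `[x_i] A ≠ 0` then `ord (A + φ²) ≤ 1`, contradicting `ord > 2`. -/
theorem false_of_coeff_single_one_ne_zero {A : MvPowerSeries (Fin 2) k} {α β : k}
    (hord : (2 : ℕ∞) < (A + (C α * X 0 + C β * X 1) ^ 2).order) (i : Fin 2)
    (h : coeff (Finsupp.single i 1) A ≠ 0) : False := by
  apply h
  have h12 : ((1 : ℕ) : ℕ∞) < 2 := by norm_num
  have h1 : coeff (Finsupp.single i 1) (A + (C α * X 0 + C β * X 1) ^ 2) = 0 :=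
    coeff_of_lt_order (by rw [Finsupp.degree_single]; exact lt_trans h12 hord)
  have h2 : coeff (Finsupp.single i 1) ((C α * X 0 + C β * X 1 : MvPowerSeries (Fin 2) k) ^ 2) = 0 :=
    coeff_of_lt_order (by rw [Finsupp.degree_single]; exact lt_of_lt_of_le h12 (two_le_order_sq_linear α β))
  rwa [map_add, h2, add_zero] at h1

/-- The coefficient `[x_i²] (x_i² · W) = W(0)`. -/
theorem coeff_single_two_X_sq_mul (i : Fin 2) (W : MvPowerSeries (Fin 2) k) :
    coeff (Finsupp.single i 2) (X i ^ 2 * W) = constantCoeff W := by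
  classical
  rw [X_pow_eq, coeff_monomial_mul, if_pos le_rfl, tsub_self, one_mul, coeff_zero_eq_constantCoeff_apply]

/-- Coefficients below the power of `x_i` dividing vanish. -/
theorem coeff_X_pow_mul_eq_zero {i : Fin 2} {n : ℕ} {d : Fin 2 →₀ ℕ} (h : d i < n) (W : MvPowerSeries (Fin 2) k) :
    coeff d (X i ^ n * W) = 0 := by
  classical
  rw [X_pow_eq, coeff_monomial_mul, if_neg]
  intro hle
  have := hle i
  rw [Finsupp.single_eq_same] at this
  omega

/-- `x_i^n · W` has order `≥ n`. -/
theorem le_order_X_pow_mul (i : Fin 2) (n : ℕ) (W : MvPowerSeries (Fin 2) k) : ((n : ℕ) : ℕ∞) ≤ (X i ^ n * W).order := by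
  refine nat_le_order fun d hd => coeff_X_pow_mul_eq_zero ?_ W
  have h : (d i : ℕ) ≤ d.degree := by
    rw [Finsupp.degree_eq_sum]
    exact Finset.single_le_sum (fun j _ => Nat.zero_le (d j)) (Finset.mem_univ i)
  exact_mod_cast lt_of_le_of_lt h (by exact_mod_cast hd)

/-- Cancelling `x₀²`. -/
theorem eq_of_X_sq_mul_eq {A E : MvPowerSeries (Fin 2) k} (h : X 0 ^ 2 * A = X 0 ^ 2 * E) : A = E :=
  mul_left_cancel₀ (pow_ne_zero 2 (FormalCoordChange.X_ne_zero' (0 : Fin 2))) h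

/-! ### The two charts, evaluated -/

/-- The chart `π_{0,c}`: `x₀ ↦ c₀ x₀`. -/
theorem pi_zero_apply_zero (c : Fin 2 → k) :
    (if (0 : Fin 2) = 0 then C (c 0) * X 0 else X 0 * (C (c 0) + (X 1 : MvPowerSeries (Fin 2) k))) = C (c 0) * X 0 :=
  if_pos rfl

/-- The chart `π_{0,c}`: `x₁ ↦ x₀ (c₁ + x₁)`. -/
theorem pi_zero_apply_one (c : Fin 2 → k) :
    (if (1 : Fin 2) = 0 then C (c 0) * X 0 else X 0 * (C (c 1) + (X 1 : MvPowerSeries (Fin 2) k))) =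
      X 0 * (C (c 1) + X 1) :=
  if_neg one_ne_zero

/-- The chart `π_{1,c}`: `x₀ ↦ x₀ (c₀ + x₁)`. -/
theorem pi_one_apply_zero (c : Fin 2 → k) :
    (if (0 : Fin 2) = 1 then C (c 1) * X 0 else X 0 * (C (c 0) + (X 1 : MvPowerSeries (Fin 2) k))) =
      X 0 * (C (c 0) + X 1) :=
  if_neg zero_ne_one

/-- The chart `π_{1,c}`: `x₁ ↦ c₁ x₀`. -/
theorem pi_one_apply_one (c : Fin 2 → k) :
    (if (1 : Fin 2) = 1 then C (c 1) * X 0 else X 0 * (C (c 1) + (X 1 : MvPowerSeries (Fin 2) k))) = C (c 1) * X 0 :=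
  if_pos rfl

/-! ### The three-lines position `x₀ x₁ (a x₁² + e x₀²)` -/

/-- ONE CHART of the point blow-up of the three-lines position (characteristic `2`, `k` algebraically closed; `a, e, c₀ ≠ 0`):
if `x₀² · A' = C a (c₀x₀)(x₀(c₁+x₁))³ + C e (c₀x₀)³(x₀(c₁+x₁))` then the cleaned successor `A' + (αx₀ + βx₁)²`
(`α² = [x₀²]A'`, `β² = [x₁²]A'`) is won: it is `x₀²x₁ · unit` off the special line `a c₁² + e c₀² = 0`, and on it
`x₀²x₁²(c₁ + x₁) · unit`, cleaned once more (`won_dp_add_sq_iff`) to `x₀²x₁³ · unit` — terminal double points. -/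
theorem threeLines_chart [CharP k 2] [IsAlgClosed k]
    (hlow : ∀ g : MvPowerSeries (Fin 1) k, CobordantGame.IsSingular k g → CobordantGame.Won k 1 g)
    {a e c₀ c₁ : k} (ha : a ≠ 0) (he : e ≠ 0) (hc₀ : c₀ ≠ 0) {A' : MvPowerSeries (Fin 2) k} {α β : k}
    (hfac : X 0 ^ 2 * A' = C a * (C c₀ * X 0) * (X 0 * (C c₁ + X 1)) ^ 3 + C e * (C c₀ * X 0) ^ 3 * (X 0 * (C c₁ + X 1)))
    (hα : α ^ 2 = coeff (Finsupp.single 0 2) A') (hβ : β ^ 2 = coeff (Finsupp.single 1 2) A') :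
    CobordantGame.Won k 3 (X (Fin.last 2) ^ 2 + rename (Fin.succAboveEmb (Fin.last 2)) (A' + (C α * X 0 + C β * X 1) ^ 2)) := by
  have h2 := SepPointStep.two_eq_zero (k := k)
  -- the successor
  set G : MvPowerSeries (Fin 2) k := C c₀ * (C c₁ + X 1) * (C a * (C c₁ + X 1) ^ 2 + C e * C c₀ ^ 2) with hG
  have hA' : A' = X 0 ^ 2 * G := eq_of_X_sq_mul_eq (by rw [hfac, hG]; ring)
  have hG0 : constantCoeff G = c₀ * c₁ * (a * c₁ ^ 2 + e * c₀ ^ 2) := by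
    rw [hG]; simp [constantCoeff_X]
  -- the cleaning data
  have hβ0 : β = 0 := by
    rw [hA', coeff_X_pow_mul_eq_zero (by rw [Finsupp.single_apply, if_neg one_ne_zero]; exact two_pos)] at hβ
    exact pow_eq_zero_iff two_ne_zero |>.mp hβ
  subst hβ0
  rw [hA', coeff_single_two_X_sq_mul, hG0] at hα
  have hαC : (C α : MvPowerSeries (Fin 2) k) ^ 2 = C c₀ * C c₁ * (C a * C c₁ ^ 2 + C e * C c₀ ^ 2) := by
    rw [← map_pow, hα]; simp only [map_mul, map_add, map_pow]
  -- the cleaned successor is `x₀² x₁ · U`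
  set γ : k := a * c₁ ^ 2 + e * c₀ ^ 2 with hγ
  set U : MvPowerSeries (Fin 2) k := C c₀ * (C γ + C (c₁ * a) * X 1 + C a * X 1 ^ 2) with hU
  have hclean : A' + (C α * X 0 + C (0 : k) * X 1) ^ 2 = X 0 ^ 2 * X 1 ^ 1 * U := by
    rw [map_zero, zero_mul, add_zero, mul_pow, hαC, hA', hG, hU, hγ]
    simp only [map_add, map_mul, map_pow]
    linear_combination (X 0 ^ 2 * C c₀ * C c₁ * (C a * C c₁ ^ 2 + C e * C c₀ ^ 2 + C a * C c₁ * X 1 + C a * X 1 ^ 2)) * h2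
  rw [hclean]
  by_cases hγ0 : γ = 0
  · -- on the special line: one more cleaning
    have hc₁ : c₁ ≠ 0 := by
      rintro rfl
      apply he
      have : e * c₀ ^ 2 = 0 := by rw [hγ] at hγ0; simpa using hγ0
      exact (mul_eq_zero.mp this).resolve_right (pow_ne_zero 2 hc₀)
    obtain ⟨s, hs⟩ := IsAlgClosed.exists_pow_nat_eq (c₀ * c₁ * a) two_pos
    have hsC : (C s : MvPowerSeries (Fin 2) k) ^ 2 = C c₀ * C c₁ * C a := by rw [← map_pow, hs, map_mul, map_mul]
    have hφ : constantCoeff (C s * X 0 * X 1 : MvPowerSeries (Fin 2) k) = 0 := by simp [constantCoeff_X]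
    refine (InsepDoublePoint.won_dp_add_sq_iff (C s * X 0 * X 1) hφ _).mp ?_
    have hclean2 : X 0 ^ 2 * X 1 ^ 1 * U + (C s * X 0 * X 1) ^ 2 = X 0 ^ 2 * X 1 ^ 3 * C (c₀ * a) := by
      rw [hU, hγ0, map_zero, zero_add, map_mul, map_mul, mul_pow, mul_pow, hsC]
      linear_combination (X 0 ^ 2 * X 1 ^ 2 * C c₀ * C c₁ * C a) * h2
    rw [hclean2]
    exact TerminalDoublePoint.binomialDoublePointWon 2 Nat.prime_two k hlow 5 2 3 _ le_rfl (by rw [constantCoeff_C]; exact mul_ne_zero hc₀ ha)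
      (fun h => by have := h.2; omega)
  · exact TerminalDoublePoint.binomialDoublePointWon 2 Nat.prime_two k hlow 3 2 1 U le_rfl
      (by rw [hU]; simp [constantCoeff_X]; exact ⟨hc₀, hγ0⟩) (fun h => by have := h.2; omega)

end KangarooWalk

open KangarooWalk InsepDoublePoint MvPowerSeries in
/-- THE THREE-LINES POSITION IS WON (characteristic `2`, `k` algebraically closed): `y² + x₀x₁(a x₁² + e x₀²)`, `a, e ≠ 0` —
one point blow-up; every singular successor, cleaned, is a terminal double point (`KangarooWalk.threeLines_chart` in both
charts; the chart of `x₁` is the chart of `x₀` with `(a, e, c₀, c₁) ↦ (e, a, c₁, c₀)`). [OURS · L1 W4.3, calibration (c3)] -/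
theorem threeLinesDoublePointWon (k : Type) [Field k] [CharP k 2] [IsAlgClosed k] {a e : k} (ha : a ≠ 0) (he : e ≠ 0) :
    CobordantGame.Won k 3 (MvPowerSeries.X (Fin.last 2) ^ 2 + MvPowerSeries.rename (Fin.succAboveEmb (Fin.last 2))
      (MvPowerSeries.C a * MvPowerSeries.X 0 * MvPowerSeries.X 1 ^ 3 +
        MvPowerSeries.C e * MvPowerSeries.X 0 ^ 3 * MvPowerSeries.X 1)) := by
  have hlow : ∀ g : MvPowerSeries (Fin 1) k, CobordantGame.IsSingular k g → CobordantGame.Won k 1 g :=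
    fun g hg => PlaneWon.lineWon g hg
  have hA : (C a * X 0 * X 1 ^ 3 + C e * X 0 ^ 3 * X 1 : MvPowerSeries (Fin 2) k) =
      C a * X 0 ^ 1 * X 1 ^ 3 + C e * X 0 ^ 3 * X 1 ^ 1 := by rw [pow_one, pow_one]
  refine won_insep_of_pointStep k hlow _ ?_ fun c i₀ hc A' α β hfac hα hβ _ => ?_
  · rw [hA]
    have h3 : ((3 : ℕ) : ℕ∞) ≤ (C a * X 0 ^ 1 * X 1 ^ 3 + C e * X 0 ^ 3 * X 1 ^ 1 : MvPowerSeries (Fin 2) k).order :=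
      le_order_add' (le_trans (by norm_num) (le_order_term a 1 3)) (le_trans (by norm_num) (le_order_term e 3 1))
    exact lt_of_lt_of_le (by norm_num) h3
  · have hs := hasSubst_pi i₀ c
    rw [hA, subst_add hs, subst_term hs, subst_term hs] at hfac
    rcases (by fin_cases i₀ <;> simp : i₀ = 0 ∨ i₀ = 1) with rfl | rfl
    · rw [pi_zero_apply_zero, pi_zero_apply_one] at hfac
      refine threeLines_chart hlow (c₁ := c 1) ha he hc ?_ hα hβ
      rw [← hfac]; ring
    · rw [pi_one_apply_zero, pi_one_apply_one] at hfac
      refine threeLines_chart hlow (c₁ := c 0) he ha hc ?_ hα hβ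
      rw [← hfac]; ring

end Summit.ResolutionOfSingularities.ResolutionOfSingularities.Theorems
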